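import Literature.Probability.LatticeModels.SRWKilledWalkFunctionals
import Literature.Probability.RandomPlanarGeometry.ChordalLERWScalingLimit
import HarnessLib

/-!
# The site-killed Green's function only sees the component of the starting point;
# a reachability class of a site graph is a connected induced subgraph of `ℤ²`
— helper of stub `stub_greenConvergence` (GC) of line `symplectic-fermion-anchor`
(crux `SAWLoopFugacityFlow.AvoidanceLimit`, stmt-CriticalPhenomena-10649; lead c2 GC-sandwich
programme, brick W-B)

**What.** For a vertex set `A ⊆ ℤ²` let `siteGraph A` be the nearest-neighbour graph of `ℤ²` with
all sites outside `A` isolated (`ChordalLERW.siteGraph`), and for a start `u` let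
`C = {x | (siteGraph A).Reachable u x}` be the reachability class of `u`.

* `killedGreen_siteGraph_eq_killedGreen_siteGraph_reachable` (registered signature): the Green's
  function of the simple random walk from `u` killed at its first non-`siteGraph A` step equals the
  one killed at its first non-`siteGraph C` step, `G_{A}(u, v) = G_{C}(u, v)`: a walk from `u`
  along `siteGraph A`-edges never leaves `C`, and on `C` the two graphs have the same edges.
  In fact the two `n`-step transition events coincide for every `n`
  (`killedTrans_siteGraph_eq_killedTrans_siteGraph_reachable`).
* `induce_setOf_reachable_connected` (registered signature): the subgraph of `ℤ²` induced on the
  reachability class `{x | (siteGraph A).Reachable b x}` is connected (it contains `b`, and a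
  `siteGraph A`-walk from `b` is a walk of the induced graph).

**Proof.** Elementary graph combinatorics: `siteGraph C ≤ siteGraph A` always (two distinct
mutually reachable points both lie in `A`, by the first dart of a walk of positive length), and an
`A`-edge issued from a point of `C` is a `C`-edge; induction along the time parameter of the
transit event, resp. along a walk. Folklore; nothing from the literature is asserted here.
-/

noncomputable section

open scoped BigOperators Topology
open Filter Finset
open Literature.Probability.RandomPlanarGeometry Literature.Probability.LatticeModels

namespace Summit.CriticalPhenomena.SAWScalingLimit.Theorems.AvoidanceLimit.Anchor

/-! ## The reachability class and its site graph -/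

/-- Two distinct points joined by a `siteGraph A`-walk lie in `A` (here: the starting point; the
walk has positive length and its first dart starts in `A`). [folklore] -/
theorem mem_of_siteGraph_reachable_of_ne {A : Set (Site 2)} {x y : Site 2}
    (h : (ChordalLERW.siteGraph A).Reachable x y) (hne : x ≠ y) : x ∈ A := by
  obtain ⟨w⟩ := h
  cases w with
  | nil => exact absurd rfl hne
  | cons hadj _ => exact (ChordalLERW.siteGraph_adj_iff.1 hadj).2.1

/-- The site graph of the reachability class of `u` is a subgraph of `siteGraph A`: an edge of it
joins two distinct points of the class, which are mutually `siteGraph A`-reachable, hence both in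
`A`. [folklore] -/
theorem siteGraph_setOf_reachable_le (A : Set (Site 2)) (u : Site 2) :
    ChordalLERW.siteGraph {x : Site 2 | (ChordalLERW.siteGraph A).Reachable u x} ≤
      ChordalLERW.siteGraph A := by
  intro x y hxy
  obtain ⟨hzd, hx, hy⟩ := ChordalLERW.siteGraph_adj_iff.1 hxy
  have hxy' : (ChordalLERW.siteGraph A).Reachable x y := hx.symm.trans hy
  exact ChordalLERW.siteGraph_adj_iff.2 ⟨hzd, mem_of_siteGraph_reachable_of_ne hxy' hzd.ne,
    mem_of_siteGraph_reachable_of_ne hxy'.symm hzd.ne.symm⟩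

/-- A `siteGraph A`-edge issued from a point of the reachability class of `u` is an edge of the
site graph of that class (its endpoint is again reachable). [folklore] -/
theorem siteGraph_setOf_reachable_adj {A : Set (Site 2)} {u x y : Site 2}
    (hx : (ChordalLERW.siteGraph A).Reachable u x) (hxy : (ChordalLERW.siteGraph A).Adj x y) :
    (ChordalLERW.siteGraph {z : Site 2 | (ChordalLERW.siteGraph A).Reachable u z}).Adj x y :=
  ChordalLERW.siteGraph_adj_iff.2 ⟨(ChordalLERW.siteGraph_adj_iff.1 hxy).1, hx,
    hx.trans hxy.reachable⟩

/-! ## The component lemma for the killed walk -/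

/-- Along a path whose first `n` steps from `u` are `siteGraph A`-edges, every position up to
time `n` is `siteGraph A`-reachable from `u`. [folklore] -/
theorem siteGraph_reachable_pos {A : Set (Site 2)} {u : Site 2} {ω : SRW.PathSpace 2} {n : ℕ}
    (h : ∀ j < n, (ChordalLERW.siteGraph A).Adj (u + SRW.S ω j) (u + SRW.S ω (j + 1))) :
    ∀ j ≤ n, (ChordalLERW.siteGraph A).Reachable u (u + SRW.S ω j) := by
  intro j
  induction j with
  | zero =>
    intro _
    rw [SRW.S_zero, add_zero]
  | succ j ih =>
    intro hj
    exact (ih (Nat.le_of_succ_le hj)).trans (h j hj).reachable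

/-- The transit events coincide: the first `n` steps from `u` are `siteGraph A`-edges iff they are
edges of the site graph of the reachability class of `u`. [folklore] -/
theorem forall_siteGraph_adj_iff_setOf_reachable {A : Set (Site 2)} (u : Site 2)
    (ω : SRW.PathSpace 2) (n : ℕ) :
    (∀ j < n, (ChordalLERW.siteGraph A).Adj (u + SRW.S ω j) (u + SRW.S ω (j + 1))) ↔
      ∀ j < n, (ChordalLERW.siteGraph
        {x : Site 2 | (ChordalLERW.siteGraph A).Reachable u x}).Adj
          (u + SRW.S ω j) (u + SRW.S ω (j + 1)) := by
  constructor
  · intro h j hj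
    exact siteGraph_setOf_reachable_adj (siteGraph_reachable_pos h j hj.le) (h j hj)
  · intro h j hj
    exact siteGraph_setOf_reachable_le A u (h j hj)

/-- **The `n`-step transition functions of the walk killed off `siteGraph A` and of the walk
killed off the site graph of the component of the start coincide.** [folklore] -/
theorem killedTrans_siteGraph_eq_killedTrans_siteGraph_reachable (A : Set (Site 2)) (n : ℕ)
    (u v : Site 2) :
    SRW.killedTrans (ChordalLERW.siteGraph A) n u v =
      SRW.killedTrans (ChordalLERW.siteGraph
        {x : Site 2 | (ChordalLERW.siteGraph A).Reachable u x}) n u v := by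
  unfold SRW.killedTrans
  exact congrArg (SRW.pathLaw 2).real
    (Set.ext fun ω => (forall_siteGraph_adj_iff_setOf_reachable u ω n).and Iff.rfl)

/-- **The site-killed Green's function only sees the component of the starting point**:
`G_{siteGraph A}(u, v) = G_{siteGraph C}(u, v)` for the `siteGraph A`-reachability class `C` of
`u` (termwise equality of the series). [folklore] -/
theorem killedGreen_siteGraph_eq_killedGreen_siteGraph_reachable :
    ∀ (A : Set (Site 2)) (u v : Site 2),
      SRW.killedGreen (ChordalLERW.siteGraph A) u v =
        SRW.killedGreen (ChordalLERW.siteGraph {x : Site 2 | (ChordalLERW.siteGraph A).Reachable u x}) u v := by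
  intro A u v
  unfold SRW.killedGreen
  exact tsum_congr fun n => killedTrans_siteGraph_eq_killedTrans_siteGraph_reachable A n u v

/-! ## A reachability class induces a connected subgraph of `ℤ²` -/

/-- A `siteGraph A`-walk between two points of the reachability class of `b` is a walk of the
subgraph of `ℤ²` induced on that class (walk induction: every vertex of the walk is in the class,
every step is a nearest-neighbour step). [folklore] -/
theorem induce_setOf_reachable_reachable {A : Set (Site 2)} {b y z : Site 2}
    (w : (ChordalLERW.siteGraph A).Walk y z) (hy : (ChordalLERW.siteGraph A).Reachable b y)
    (hz : (ChordalLERW.siteGraph A).Reachable b z) :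
    ((zdGraph 2).induce {x : Site 2 | (ChordalLERW.siteGraph A).Reachable b x}).Reachable
      ⟨y, hy⟩ ⟨z, hz⟩ := by
  induction w with
  | nil => exact SimpleGraph.Reachable.refl _
  | cons h p ih =>
    rename_i y c z
    have hc : (ChordalLERW.siteGraph A).Reachable b c := hy.trans h.reachable
    have hadj : ((zdGraph 2).induce
        {x : Site 2 | (ChordalLERW.siteGraph A).Reachable b x}).Adj ⟨y, hy⟩ ⟨c, hc⟩ :=
      (ChordalLERW.siteGraph_adj_iff.1 h).1
    exact hadj.reachable.trans (ih hc hz)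

/-- **A reachability class of a site graph induces a connected subgraph of `ℤ²`**: it contains
`b`, and each of its points is joined to `b` inside it. [folklore] -/
theorem induce_setOf_reachable_connected :
    ∀ (A : Set (Site 2)) (b : Site 2),
      ((zdGraph 2).induce {x : Site 2 | (ChordalLERW.siteGraph A).Reachable b x}).Connected := by
  intro A b
  rw [SimpleGraph.connected_iff_exists_forall_reachable]
  refine ⟨⟨b, SimpleGraph.Reachable.refl b⟩, ?_⟩
  rintro ⟨x, hx⟩
  exact induce_setOf_reachable_reachable hx.some (SimpleGraph.Reachable.refl b) hx

end Summit.CriticalPhenomena.SAWScalingLimit.Theorems.AvoidanceLimit.Anchor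

end
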